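import Mathlib.MeasureTheory.Group.ModularCharacter
import Mathlib.MeasureTheory.Group.Integral
import HarnessLib

/-!
# Haar measure is invariant under conjugation by elements of a compact subgroup

Topic `NumberTheory/Automorphic` (support file; used for the `K_∞`-equivariance of convolution
operators `φ ↦ ∫ φ(g x) α(x) dν(x)` by `Ad(K_∞)`-invariant test functions on `G_∞ = GL_n(K_∞)`).
For a second countable locally compact group `G` with a (left) Haar measure `ν` and a compact
subgroup `K`:

* `modularCharacter_eq_one_of_mem_isCompact` (**proved**): the modular character `Δ` is trivial
  on `K` (`Δ|_K` is a bounded homomorphism into `ℝ_{>0}`: `Δ(k) = ∫ f(xk) dν / ∫ f dν ≤ M` for a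
  fixed bump `f`, uniformly in `k ∈ K`, and a bounded subgroup of `ℝ_{>0}` is trivial);
* `map_mul_right_eq_self_of_mem_isCompact` (**proved**): `ν` is right-invariant under `K`;
* `map_conj_eq_self_of_mem_isCompact`, `integral_conj_eq_self_of_mem_isCompact` (**proved**):
  `ν(k S k⁻¹) = ν(S)` and `∫ F(k x k⁻¹) dν = ∫ F dν` for `k ∈ K`.

Standard (Weil, *L'intégration dans les groupes topologiques*, §8; Bourbaki, *Intégration*
VII §1 no. 3, Cor. of Prop. 4: `Δ` is trivial on every compact subgroup; Knapp 2002, VIII.§2,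
(8.27)–(8.30)). Everything here is proved; theorems only.

## References

* A. W. Knapp, *Lie Groups Beyond an Introduction* (2002), VIII.§2.
* N. Bourbaki, *Intégration*, Ch. VII §1 no. 3.
-/

noncomputable section

open MeasureTheory MeasureTheory.Measure Filter Topology
open scoped NNReal ENNReal Pointwise

namespace Literature.NumberTheory.Automorphic

variable {G : Type*} [Group G] [TopologicalSpace G] [IsTopologicalGroup G] [LocallyCompactSpace G]
  [MeasurableSpace G] [BorelSpace G]

/-- **A bound for the modular character on a compact set**: there is `M` with `Δ(k) ≤ M` for all
`k` in the compact set `C` (`Δ(k) = ∫ f(xk) dν / ∫ f dν` for a fixed non-negative bump `f`, and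
`x ↦ f(xk)` is bounded by `sup f` and supported in the compact set `supp f · C⁻¹`).
Knapp 2002, VIII.§2; Bourbaki, *Intégration* VII §1 no. 3. [folklore] -/
theorem exists_modularCharacter_le_of_isCompact {C : Set G} (hC : IsCompact C) :
    ∃ M : ℝ≥0, ∀ k ∈ C, modularCharacter k ≤ M := by
  classical
  borelize G
  set ν : Measure G := MeasureTheory.Measure.haar with hν
  obtain ⟨⟨f, f_cont⟩, f_comp, f_nonneg, f_one⟩ :
    ∃ f : C(G, ℝ), HasCompactSupport f ∧ 0 ≤ f ∧ f 1 ≠ 0 := exists_continuous_nonneg_pos 1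
  have f_comp' : HasCompactSupport f := f_comp
  have f_nonneg' : ∀ x, 0 ≤ f x := fun x => f_nonneg x
  have int_f_pos : 0 < ∫ x, f x ∂ν :=
    f_cont.integral_pos_of_hasCompactSupport_nonneg_nonzero f_comp' f_nonneg f_one
  -- a uniform bound for `f`
  obtain ⟨B, hB⟩ : ∃ B, ∀ x, f x ≤ B := by
    obtain ⟨B, hB⟩ := (f_cont.norm).bddAbove_range_of_hasCompactSupport f_comp'.norm
    exact ⟨B, fun x => (le_abs_self _).trans ((Real.norm_eq_abs _).symm.le.trans
      (hB (Set.mem_range_self x)))⟩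
  have hB0 : 0 ≤ B := (f_nonneg' 1).trans (hB 1)
  -- the common support of the translates `x ↦ f (x k)`, `k ∈ C`, and a measurable hull
  set S : Set G := tsupport f * C⁻¹ with hS
  have hScpt : IsCompact S := f_comp'.isCompact.mul hC.inv
  set S' : Set G := toMeasurable ν S with hS'
  have hS'meas : MeasurableSet S' := measurableSet_toMeasurable ν S
  have hS'fin : ν S' < ∞ := by
    rw [hS', measure_toMeasurable]
    exact hScpt.measure_lt_top
  have hsub : S ⊆ S' := subset_toMeasurable ν S
  refine ⟨((B * (ν S').toReal) / ∫ x, f x ∂ν).toNNReal, fun k hk => ?_⟩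
  -- `Δ(k) = ∫ f(xk) / ∫ f`
  have hΔ : (modularCharacter k : ℝ) = (∫ x, f (x * k) ∂ν) / ∫ x, f x ∂ν := by
    change (modularCharacterFun k : ℝ) = _
    rw [modularCharacterFun_eq_haarScalarFactor ν k,
      haarScalarFactor_eq_integral_div _ _ f_cont f_comp' int_f_pos.ne',
      integral_map (AEMeasurable.mul_const aemeasurable_id' _) (f_cont.aestronglyMeasurable)]
  -- bound the numerator
  have hsupp : ∀ x, x ∉ S → f (x * k) = 0 := by
    intro x hx
    by_contra h
    have hxk : x * k ∈ tsupport f := subset_tsupport _ (Function.mem_support.2 h)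
    exact hx ⟨x * k, hxk, k⁻¹, Set.inv_mem_inv.2 hk, by group⟩
  have hptw : ∀ x, f (x * k) ≤ S'.indicator (fun _ => B) x := fun x => by
    by_cases hx : x ∈ S
    · rw [Set.indicator_of_mem (hsub hx)]
      exact hB _
    · rw [hsupp x hx]
      exact Set.indicator_nonneg (fun _ _ => hB0) x
  have hle : ∫ x, f (x * k) ∂ν ≤ B * (ν S').toReal := by
    have hint1 : Integrable (fun x => f (x * k)) ν :=
      (f_cont.comp (continuous_mul_const k)).integrable_of_hasCompactSupport
        (f_comp'.comp_homeomorph (Homeomorph.mulRight k))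
    have hint2 : Integrable (S'.indicator fun _ => B) ν :=
      (integrable_indicator_iff hS'meas).2 (integrableOn_const hS'fin.ne)
    calc ∫ x, f (x * k) ∂ν ≤ ∫ x, S'.indicator (fun _ => B) x ∂ν := integral_mono hint1 hint2 hptw
      _ = B * (ν S').toReal := by
          rw [integral_indicator_const B hS'meas, smul_eq_mul, mul_comm]
          rfl
  rw [← NNReal.coe_le_coe, Real.coe_toNNReal _ (by positivity), hΔ]
  exact div_le_div_of_nonneg_right hle int_f_pos.le

/-- **The modular character is trivial on compact subgroups** (a bounded subgroup of `ℝ_{>0}` is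
trivial). Bourbaki, *Intégration* VII §1 no. 3, Cor. of Prop. 4; Knapp 2002, VIII.§2. [folklore] -/
theorem modularCharacter_eq_one_of_mem_isCompact {K : Subgroup G} (hK : IsCompact (K : Set G))
    {k : G} (hk : k ∈ K) : modularCharacter k = 1 := by
  obtain ⟨M, hM⟩ := exists_modularCharacter_le_of_isCompact hK
  -- `Δ(k)^n ≤ M` for all `n`, and the same for `k⁻¹`
  have hpow : ∀ g ∈ K, modularCharacter g ≤ 1 := by
    intro g hg
    by_contra h
    rw [not_le] at h
    have h1 : (1 : ℝ) < modularCharacter g := by exact_mod_cast h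
    obtain ⟨n, hn⟩ := pow_unbounded_of_one_lt (M : ℝ) h1
    have hle : modularCharacter (g ^ n) ≤ M := hM _ (K.pow_mem hg n)
    rw [map_pow] at hle
    have : ((modularCharacter g : ℝ≥0) : ℝ) ^ n ≤ M := by exact_mod_cast hle
    exact (lt_irrefl _) (this.trans_lt hn)
  have h1 := hpow k hk
  have h2 := hpow k⁻¹ (K.inv_mem hk)
  have hpos : 0 < modularCharacter k := modularCharacterFun_pos k
  rw [map_inv, inv_le_one₀ hpos] at h2
  exact le_antisymm h1 h2

variable [SecondCountableTopology G] (ν : Measure G) [ν.IsHaarMeasure]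

/-- **A Haar measure is right-invariant under compact subgroups**: `ν(S k) = ν(S)` for `k` in a
compact subgroup. Bourbaki, *Intégration* VII §1 no. 3. [folklore] -/
theorem map_mul_right_eq_self_of_mem_isCompact {K : Subgroup G} (hK : IsCompact (K : Set G))
    {k : G} (hk : k ∈ K) : ν.map (· * k) = ν := by
  have h := isMulLeftInvariant_eq_smul (ν.map (· * k)) ν
  have hfac : haarScalarFactor (ν.map (· * k)) ν = 1 := by
    rw [← modularCharacterFun_eq_haarScalarFactor ν k]
    exact modularCharacter_eq_one_of_mem_isCompact hK hk
  rw [hfac, one_smul] at h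
  exact h

/-- **A Haar measure is invariant under conjugation by elements of a compact subgroup**:
`ν(k S k⁻¹) = ν(S)`. Bourbaki, *Intégration* VII §1 no. 3; Knapp 2002, VIII.§2. [folklore] -/
theorem map_conj_eq_self_of_mem_isCompact {K : Subgroup G} (hK : IsCompact (K : Set G))
    {k : G} (hk : k ∈ K) : ν.map (fun x => k * x * k⁻¹) = ν := by
  have hcomp : (fun x => k * x * k⁻¹) = (· * k⁻¹) ∘ (k * ·) := by
    funext x; rfl
  rw [hcomp, ← Measure.map_map (measurable_mul_const _) (measurable_const_mul _),
    map_mul_left_eq_self, map_mul_right_eq_self_of_mem_isCompact ν hK (K.inv_mem hk)]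

/-- **Change of variables `x ↦ k x k⁻¹` in Haar integrals**, `k` in a compact subgroup:
`∫ F(k x k⁻¹) dν = ∫ F dν` (for every `F`, no measurability needed: conjugation is a measurable
equivalence preserving `ν`). Bourbaki, *Intégration* VII §1 no. 3. [folklore] -/
theorem integral_conj_eq_self_of_mem_isCompact {E : Type*} [NormedAddCommGroup E] [NormedSpace ℝ E]
    {K : Subgroup G} (hK : IsCompact (K : Set G)) {k : G} (hk : k ∈ K) (F : G → E) :
    ∫ x, F (k * x * k⁻¹) ∂ν = ∫ x, F x ∂ν := by
  set e : G ≃ᵐ G := (MeasurableEquiv.mulLeft k).trans (MeasurableEquiv.mulRight k⁻¹) with he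
  have hecoe : (e : G → G) = fun x => k * x * k⁻¹ := by
    funext x
    simp [he, MeasurableEquiv.coe_mulLeft, MeasurableEquiv.coe_mulRight]
  have hmap : ν.map e = ν := by
    rw [hecoe]
    exact map_conj_eq_self_of_mem_isCompact ν hK hk
  calc ∫ x, F (k * x * k⁻¹) ∂ν = ∫ x, F (e x) ∂ν := by rw [hecoe]
    _ = ∫ y, F y ∂(ν.map e) := (integral_map_equiv e F).symm
    _ = ∫ y, F y ∂ν := by rw [hmap]

end Literature.NumberTheory.Automorphic
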